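import Literature.NumberTheory.ComplexMultiplication.CMOrderBassCyclicQuotientIdealClasses
import HarnessLib

/-!
# Bass orders: `𝒪_K/S` cyclic ⟺ every over-order Gorenstein ⟺ every ideal 2-generated (MARSEGLIA 2024 PROP. 4.6)

[cite: Marseglia2024CMType, §4 Prop. 4.6, Prop. 4.5 and Lemma 4.2, pp. 10–11]
[cite: Greither1982TwoGenerator, §1 Prop. 1.1 and Lemma 1.3, pp. 266–267; §2 Thm. 2.3, p. 268]
[cite: BuchmannLenstra1994, §2 Prop. 2.7, p. 230] [cite: Marseglia2019, §3 Prop. 3.7, p. 6]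

MARSEGLIA 2024 PROPOSITION 4.6: «Let `S` be an order. The following are equivalent: (i) For every overorder `T` of
`S` we have `type(T) = 1`. (ii) Every overorder of `S` is Gorenstein. (iii) Every fractional `S`-ideal `I` is
invertible as a fractional `(I:I)`-ideal. (iv) The `S`-module `𝒪_K/S` is cyclic. (v) `gens(S) = 2`.»  An order is
*Bass* when it satisfies these conditions.  The files `CMOrderBassCyclicQuotient` (g29-#2) and
`CMOrderBassCyclicQuotientIdealClasses` (g29-#3) prove (iv) ⟹ (v) ⟹ (i) ⟹ (ii), (iii); this file proves the
converse implications and packages the equivalences, for the orders `S = endOrder (M_μ)` of a number field `K`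
(`μ` a `ℚ`-basis of `K`), the maximal order being the fractional ideal `M` with `↑M = 𝒪_K` and «`𝒪_K/S` cyclic»
being spelled `↑M = S·1 + S·ω`.

## The printed argument and the formalisation

(ii) ⟹ (iv) («(ii) and (iv) are equivalent by [Greither, Thm. 2.3 ((a) ⟺ (e))]»; GREITHER's proof of 2.3 goes
through PROP. 1.1 ⟸ and LEMMA 1.3).  We follow the route through MARSEGLIA's own PROPOSITION 4.5
(`CMOrderMaximalOrderQuotientDimension`, g28-#7): at a maximal ideal `𝔭` of `S` which is not invertible, the
over-order `T = S + 𝔭𝒪_K` satisfies `dim_{S/𝔭} 𝒪_K/𝔭𝒪_K = 1 + type(T)`; if every over-order is Gorenstein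
(`type(T) = 1`, PROP. 3.4) this dimension is `2`, and at an invertible `𝔭` it is `1` (LEMMA 2.14 (i)).  Hence
`dim_{S/𝔭} 𝒪_K/𝔭𝒪_K ≤ 2` at every `𝔭`, and GREITHER's LEMMA 1.3 («As `0 ≠ 1̄ ∈ S/mS`, … `S` is generated by `1`
and one further element») — here MARSEGLIA's LEMMA 4.2 construction run with the PRESCRIBED first generator
`b₁ = 1`, which is nonzero in every `𝒪_K/𝔭𝒪_K` — gives `𝒪_K = S + Sω`
(`NumberRing.exists_eq_span_insert_of_forall_finrank_quotient_le`,
`exists_coe_eq_span_pair_of_forall_finrank_quotient_le_two`).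

The hypothesis «every over-order of `S` is Gorenstein» is used in BUCHMANN–LENSTRA's form (a) on the base
carrier `FractionalIdeal S⁰ K` — `N:(N:I) = I` for every over-order `N = NN ≠ 0` and every `N`-ideal `I ≠ 0`
(`CMOrderGorenstein`, `CMOrderBassClifford`) — and in the ring-theoretic form — `Tᵗ` invertible in
`FractionalIdeal T⁰ K` for every presentation `T = endOrder (M_ν) ⊇ S`; §2 proves that the former implies the
latter (`isUnit_traceDual_one_of_traceDual_mul_eq`, the converse of g29-#3's `exists_traceDual_mul_eq_of_isUnit`).
(v) ⟹ (i) is THEOREM 4.7's inequality `type(T) + 1 ≤ gens(T) ≤ gens(S)` (`CMOrderCohenMacaulayTypeGenerators`,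
g28-#5, and g29-#2 §3), here from the hypothesis «every fractional `S`-ideal is generated by two elements».

## What is formalised

* §1 `NumberRing.exists_eq_span_insert_of_forall_finrank_quotient_le` (LEMMA 4.2 / GREITHER LEMMA 1.3 with a
  prescribed first generator, any noetherian one-dimensional domain).
* §2 `exists_coe_eq_span_pair_of_forall_finrank_quotient_le_two` (`dim 𝒪_K/𝔭𝒪_K ≤ 2 ∀𝔭 ⟹ 𝒪_K = S + Sω`);
  `isUnit_traceDual_one_of_traceDual_mul_eq`, `isUnit_traceDual_one_of_forall_div_div_eq` (S-typed Gorenstein ⟹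
  `Tᵗ` invertible); `div_div_eq_of_forall_isUnit_traceDual_one` (conversely);
  `isUnit_traceDual_one_of_forall_spanFinrank_coe_le_two` ((v) ⟹ (ii) for every over-order);
  **`finrank_quotient_smul_top_le_two_of_forall_div_div_eq`** ((ii) ⟹ `dim 𝒪_K/𝔭𝒪_K ≤ 2`, via PROP. 4.5);
  **`exists_coe_eq_span_pair_of_forall_div_div_eq`** ((ii) ⟹ (iv)), `exists_coe_eq_span_pair_of_forall_isUnit_traceDual_one`,
  `exists_coe_eq_span_pair_of_forall_spanFinrank_coe_le_two` ((v) ⟹ (iv)).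
* §3 PROPOSITION 4.6 as `iff`s with (iv): **`exists_coe_eq_span_pair_iff_forall_div_div_eq`** ((iv) ⟺ (ii), base
  carrier), `exists_coe_eq_span_pair_iff_forall_isUnit_traceDual_one` ((iv) ⟺ (ii), all presentations
  `T = endOrder (M_ν) ⊇ S`), `exists_coe_eq_span_pair_iff_forall_iSup_finrank_traceDual_quotient_eq_one` ((iv) ⟺ (i)),
  `exists_coe_eq_span_pair_iff_forall_mul_div_self_div_eq` ((iv) ⟺ (iii)),
  `exists_coe_eq_span_pair_iff_forall_exists_idempotent_invertible` ((iv) ⟺ «`ICM(S)` is Clifford»),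
  `exists_coe_eq_span_pair_iff_forall_spanFinrank_coe_le_two` ((iv) ⟺ every ideal 2-generated) and
  **`exists_coe_eq_span_pair_iff_iSup_spanFinrank_coe_eq_two`** ((iv) ⟺ (v) `gens(S) = 2`, for `S ≠ 𝒪_K`).
-/

noncomputable section

open scoped nonZeroDivisors NumberField
open NumberField Module FractionalIdeal
open Submodule (traceDual)

namespace Literature.NumberTheory.ComplexMultiplication

/-! ## §1 LEMMA 4.2 with a prescribed first generator (GREITHER LEMMA 1.3) -/

namespace NumberRing

section AnyDomain

variable {R : Type*} [CommRing R] [IsDomain R] {K : Type*} [Field K] [Algebra R K] [IsFractionRing R K]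

/-- **MARSEGLIA 2024 LEMMA 4.2 with a prescribed first generator / GREITHER 1982 LEMMA 1.3**: let `I ≠ 0` be a
fractional ideal of the noetherian one-dimensional domain `R` with `dim_{R/𝔭} I/𝔭I ≤ n + 1` at every maximal
ideal `𝔭`, and let `b₁ ∈ I` be nonzero in EVERY `I/𝔭I`.  Then `I = Rb₁ + Rb₂ + ⋯ + Rb_{n+1}` for suitable
`b₂, …, b_{n+1} ∈ I` (the proof of LEMMA 4.2 from its Step 2 on: the finite set `𝓑 = {𝔭 : I_𝔭 ≠ b₁R_𝔭}`, local
completions of the class of `b₁` to spanning families, Chinese-remainder lifts, Nakayama prime by prime and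
`I = ⋂ I_𝔭`; GREITHER: «As `0 ≠ 1̄ ∈ S/mS`, there exist `x₂, …, x_n` [completing it to generators]»).
[cite: Marseglia2024CMType, §4 Lemma 4.2 (proof), p. 10] [cite: Greither1982TwoGenerator, §1 Lemma 1.3 (proof), p. 267] -/
theorem exists_eq_span_insert_of_forall_finrank_quotient_le [IsNoetherianRing R] [Ring.DimensionLEOne R]
    {I : FractionalIdeal R⁰ K} (hI : I ≠ 0) {n : ℕ} {b₁ : K} (hb₁I : b₁ ∈ I)
    (hb₁ : ∀ 𝔭 : MaximalSpectrum R, b₁ ∉ 𝔭.asIdeal • (I : Submodule R K))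
    (h : ∀ 𝔭 : MaximalSpectrum R, Module.finrank (R ⧸ 𝔭.asIdeal)
      ((I : Submodule R K) ⧸ (𝔭.asIdeal • ⊤ : Submodule R (I : Submodule R K))) ≤ n + 1) :
    ∃ b : Fin n → K, (∀ j, b j ∈ I) ∧ (I : Submodule R K) = Submodule.span R (insert b₁ (Set.range b)) := by
  classical
  have hfg : (I : Submodule R K).FG := fg_of_isNoetherianRing le_rfl I
  have hb₁0 : b₁ ≠ 0 := by
    obtain ⟨𝔪, h𝔪⟩ := Ideal.exists_maximal R
    rintro rfl
    exact hb₁ ⟨𝔪, h𝔪⟩ (Submodule.zero_mem _)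
  -- Step 2: the finite set `𝓑 ⊇ {𝔭 : I ≠ b₁R + 𝔭I}`
  set 𝓑 := (finite_setOf_span_coe_ne_span_singleton hI hb₁0).toFinset with h𝓑
  -- Step 3: local spanning families `b₁, t_𝔭 1, …, t_𝔭 n` of `I/𝔭I` («As `0 ≠ b̄₁`»)
  have ht : ∀ 𝔭 : MaximalSpectrum R, ∃ t : Fin n → (I : Submodule R K),
      Submodule.span (R ⧸ 𝔭.asIdeal) ((𝔭.asIdeal • ⊤ : Submodule R (I : Submodule R K)).mkQ ''
        insert ⟨b₁, hb₁I⟩ (Set.range t)) = ⊤ := by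
    intro 𝔭
    letI : Field (R ⧸ 𝔭.asIdeal) := Ideal.Quotient.field 𝔭.asIdeal
    haveI := finite_quotient_smul_top (K := K) 𝔭.asIdeal hfg
    have hv : Submodule.Quotient.mk (p := (𝔭.asIdeal • ⊤ : Submodule R (I : Submodule R K))) ⟨b₁, hb₁I⟩ ≠ 0 := by
      rw [Ne, Submodule.Quotient.mk_eq_zero, mem_smul_top_iff]
      exact hb₁ 𝔭
    obtain ⟨t, ht⟩ := exists_fin_span_insert_eq_top (h 𝔭) fun _ ↦ hv
    choose u hu using fun j ↦ Submodule.Quotient.mk_surjective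
      (𝔭.asIdeal • ⊤ : Submodule R (I : Submodule R K)) (t j)
    refine ⟨u, ?_⟩
    rw [Set.image_insert_eq, ← Set.range_comp]
    have hcomp : ((𝔭.asIdeal • ⊤ : Submodule R (I : Submodule R K)).mkQ ∘ u) = t := funext fun j ↦ hu j
    rw [hcomp]
    exact ht
  choose t ht using ht
  -- Step 4: Chinese-remainder lifts `b j ∈ I`, `b j ≡ t 𝔭 j (mod 𝔭I)` for `𝔭 ∈ 𝓑`
  have hb : ∀ j : Fin n, ∃ b ∈ (I : Submodule R K), ∀ 𝔭 ∈ 𝓑,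
      b - (t 𝔭 j : K) ∈ 𝔭.asIdeal • (I : Submodule R K) := fun j ↦
    exists_mem_forall_sub_mem_smul (I : Submodule R K) 𝓑 (fun 𝔭 ↦ (t 𝔭 j : K)) fun 𝔭 _ ↦ (t 𝔭 j).2
  choose b hbI hb using hb
  -- Step 5: `s = {b₁, b 1, …, b n}` generates `I` locally everywhere
  set s : Set K := insert b₁ (Set.range b) with hs
  have hsI : s ⊆ (I : Submodule R K) := by
    rintro x (rfl | ⟨j, rfl⟩)
    · exact hb₁I
    · exact hbI j
  have hloc : ∀ 𝔭 : MaximalSpectrum R,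
      (I : Submodule R K) ≤ Submodule.span R s ⊔ 𝔭.asIdeal • (I : Submodule R K) := by
    intro 𝔭
    by_cases h𝔭 : 𝔭 ∈ 𝓑
    · -- «if `𝔭` is in `𝓑` then this is the case by construction»
      refine (le_span_sup_smul_of_span_mkQ_eq_top 𝔭.asIdeal _ _ (ht 𝔭)).trans (sup_le ?_ le_sup_right)
      refine Submodule.span_le.2 ?_
      rintro _ ⟨z, hz, rfl⟩
      rcases hz with rfl | ⟨j, rfl⟩
      · exact Submodule.mem_sup_left (Submodule.subset_span (Set.mem_insert _ _))
      · have : ((t 𝔭 j : (I : Submodule R K)) : K) = b j - (b j - (t 𝔭 j : K)) := by ring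
        rw [this]
        exact Submodule.sub_mem _
          (Submodule.mem_sup_left (Submodule.subset_span (Set.mem_insert_of_mem _ ⟨j, rfl⟩)))
          (Submodule.mem_sup_right (hb j 𝔭 h𝔭))
    · -- «if `𝔭` is not in `𝓑` then `b₁` is a local generator at `𝔭`»
      rw [h𝓑, Set.Finite.mem_toFinset, Set.mem_setOf_eq, not_not] at h𝔭
      haveI := 𝔭.isMaximal
      exact (le_span_singleton_sup_smul_of_span_coe_eq_span_singleton 𝔭.asIdeal h𝔭).trans
        (sup_le_sup_right (Submodule.span_mono (Set.singleton_subset_iff.2 (Set.mem_insert _ _))) _)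
  -- hence `I = Rs`
  refine ⟨b, fun j ↦ hbI j, le_antisymm (fun x hx ↦ ?_) (Submodule.span_le.2 hsI)⟩
  rw [mem_iff_forall_mem_span (Submodule.span R s) x]
  intro 𝔭
  haveI := 𝔭.isMaximal
  rw [Submodule.span_span_of_tower, ← span_coe_eq_span_of_le_span_sup_smul 𝔭.asIdeal hfg hsI (hloc 𝔭)]
  exact Submodule.subset_span hx

end AnyDomain

end NumberRing

/-! ## §2 The converse implications of PROPOSITION 4.6 for `S = endOrder (M_μ)` -/

namespace CMTypeLattice

section BassConverse

variable {K : Type} [Field K] [NumberField K]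
variable {ι : Type} [Fintype ι] [DecidableEq ι] (μ : Basis ι ℚ K) [Nonempty ι]
variable [IsFractionRing (endOrder (Algebra.leftMulMatrix μ)) K]

/-- **`dim_{S/𝔭} 𝒪_K/𝔭𝒪_K ≤ 2` at every maximal `𝔭` ⟹ `𝒪_K = S + Sω`** (GREITHER PROP. 1.1 ⟸ / LEMMA 1.3 for the
extension `S ⊆ 𝒪_K`: «As `0 ≠ 1̄ ∈ S/mS`» the element `1` is a minimal generator of `𝒪_K/𝔭𝒪_K` at every `𝔭`, so
LEMMA 4.2's construction with `b₁ = 1` and `n = 1` generates `𝒪_K` by `1` and one further element `ω`).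
[cite: Greither1982TwoGenerator, §1 Prop. 1.1 and Lemma 1.3, pp. 266–267] [cite: Marseglia2024CMType, §4 Lemma 4.2
and Prop. 4.6 ((ii) ⟺ (iv) «by [Greither, Thm. 2.3]»), p. 10] -/
theorem exists_coe_eq_span_pair_of_forall_finrank_quotient_le_two
    {M : FractionalIdeal (endOrder (Algebra.leftMulMatrix μ))⁰ K}
    (hMO : (M : Set K) = (algebraMap (𝓞 K) K).range)
    (h2 : ∀ 𝔭 : MaximalSpectrum (endOrder (Algebra.leftMulMatrix μ)),
      Module.finrank (endOrder (Algebra.leftMulMatrix μ) ⧸ 𝔭.asIdeal)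
        ((M : Submodule (endOrder (Algebra.leftMulMatrix μ)) K) ⧸
          (𝔭.asIdeal • ⊤ : Submodule (endOrder (Algebra.leftMulMatrix μ))
            (M : Submodule (endOrder (Algebra.leftMulMatrix μ)) K))) ≤ 2) :
    ∃ ω ∈ M, (M : Submodule (endOrder (Algebra.leftMulMatrix μ)) K) =
      Submodule.span (endOrder (Algebra.leftMulMatrix μ)) {1, ω} := by
  haveI := isNoetherianRing_endOrder (Algebra.leftMulMatrix μ)
  haveI := dimensionLEOne_endOrder (Algebra.leftMulMatrix μ)
  obtain ⟨-, h1M⟩ := EndOrder.mul_self_le_and_one_mem_of_coe_eq_range hMO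
  have hM0 : M ≠ 0 := fun h ↦ by
    rw [h] at h1M
    exact one_ne_zero ((mem_zero_iff _).1 h1M)
  have h1 : ∀ 𝔭 : MaximalSpectrum (endOrder (Algebra.leftMulMatrix μ)),
      (1 : K) ∉ 𝔭.asIdeal • (M : Submodule (endOrder (Algebra.leftMulMatrix μ)) K) := fun 𝔭 h ↦
    one_not_mem_coeIdeal_mul μ hMO 𝔭.isMaximal.ne_top (by rwa [← NumberRing.coe_coeIdeal_mul, mem_coe] at h)
  obtain ⟨b, hbM, hMb⟩ :=
    NumberRing.exists_eq_span_insert_of_forall_finrank_quotient_le hM0 (n := 1) h1M h1 fun 𝔭 ↦ h2 𝔭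
  refine ⟨b 0, hbM 0, ?_⟩
  rw [hMb, Set.range_unique]
  rfl

/-- **S-typed Gorenstein ⟹ T-typed Gorenstein**: let `T = endOrder (M_ν)` be a presentation of the over-order
`N = NN` of `S` (`↑T = ↑N`), `Nᵗ` the trace dual on the base carrier and `Tᵗ = T′` the trace dual in
`FractionalIdeal T⁰ K`.  If `Nᵗ·B = N` for some fractional `S`-ideal `B` then `T′` is invertible (the canonical
inverse `(N:Nᵗ)` is an `N`-module, hence the carrier of a fractional `T`-ideal `B′`, and `T′B′ = 1` is read off on
lattices). [cite: BuchmannLenstra1994, §2 Prop. 2.7 ((a) ⟺ (c) «`R† (R : R†) = R`»), p. 230] [cite: Marseglia2024CMType,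
§3 Prop. 3.4 ((3) «`Sᵗ` is invertible»), p. 9] -/
theorem isUnit_traceDual_one_of_traceDual_mul_eq {ν : Basis ι ℚ K}
    [IsFractionRing (endOrder (Algebra.leftMulMatrix ν)) K]
    {N : FractionalIdeal (endOrder (Algebra.leftMulMatrix μ))⁰ K} (hNN : N * N = N)
    (hν : ∀ x : K, x ∈ endOrder (Algebra.leftMulMatrix ν) ↔ x ∈ N)
    {TN B : FractionalIdeal (endOrder (Algebra.leftMulMatrix μ))⁰ K}
    (hTN : (TN : Submodule (endOrder (Algebra.leftMulMatrix μ)) K) =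
      traceDual ℤ ℚ (N : Submodule (endOrder (Algebra.leftMulMatrix μ)) K))
    (hB : TN * B = N)
    {T' : FractionalIdeal (endOrder (Algebra.leftMulMatrix ν))⁰ K}
    (hT' : (T' : Submodule (endOrder (Algebra.leftMulMatrix ν)) K) =
      traceDual ℤ ℚ ((1 : FractionalIdeal (endOrder (Algebra.leftMulMatrix ν))⁰ K) :
        Submodule (endOrder (Algebra.leftMulMatrix ν)) K)) :
    IsUnit T' := by
  have hN0 : N ≠ 0 := fun h ↦ by
    have h1 : (1 : K) ∈ N := (hν 1).1 (Subring.one_mem _)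
    rw [h] at h1
    exact one_ne_zero ((mem_zero_iff _).1 h1)
  have hTN0 : TN ≠ 0 := fun h ↦ hN0 (by rw [← hB, h, zero_mul])
  -- the canonical inverse `B₀ = (N:Nᵗ)`, an `N`-module
  have hc : TN * (N / TN) = N := (forall_div_div_eq_iff_traceDual_mul_div_eq μ hNN hN0 hTN0 hTN).1
    fun _ hI hNI ↦ div_div_eq_of_traceDual_mul_eq μ hNN hN0 hTN hB hI hNI
  have hB₀0 : N / TN ≠ 0 := fun h ↦ hN0 (by rw [← hc, h, mul_zero])
  have hNB₀ : N * (N / TN) = N / TN := EndOrder.mul_div_eq_div_of_mul_self_eq_left hNN hN0 hTN0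
  have hSN : ∀ s ∈ endOrder (Algebra.leftMulMatrix ν), ∀ b ∈ N / TN, s * b ∈ N / TN := fun s hs b hb ↦ by
    have h := mul_mem_mul ((hν s).1 hs) hb
    rwa [hNB₀] at h
  obtain ⟨B', -, hB'⟩ := exists_overorderIdeal_coe_eq μ ν hB₀0 hSN
  have h1 : ((1 : FractionalIdeal (endOrder (Algebra.leftMulMatrix ν))⁰ K) : Set K) = (N : Set K) := by
    rw [coe_one_eq_coe_endOrder ν]
    ext x
    exact hν x
  have hTT : (TN : Set K) = (T' : Set K) := coe_eq_coe_of_coe_eq_traceDual μ h1.symm hTN hT'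
  have hmul : T' * B' = 1 := SetLike.coe_injective (by
    rw [← coe_mul_eq_coe_mul_of_coe_eq μ ν hTT hB'.symm, hc, h1])
  exact isUnit_iff_exists_inv.2 ⟨B', hmul⟩

/-- **BUCHMANN–LENSTRA (a) for the over-order `N` ⟹ `Tᵗ` invertible for its presentation `T = endOrder (M_ν)`**
(`N:(N:I) = I` for all `N`-ideals `I ≠ 0` gives `Nᵗ·(N:Nᵗ) = N`, `CMOrderGorenstein`; then the previous theorem).
[cite: BuchmannLenstra1994, §2 Prop. 2.7 ((a) ⟹ (c)), p. 230] [cite: Marseglia2024CMType, §3 Prop. 3.4, p. 9] -/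
theorem isUnit_traceDual_one_of_forall_div_div_eq {ν : Basis ι ℚ K}
    [IsFractionRing (endOrder (Algebra.leftMulMatrix ν)) K]
    {N : FractionalIdeal (endOrder (Algebra.leftMulMatrix μ))⁰ K} (hNN : N * N = N)
    (hν : ∀ x : K, x ∈ endOrder (Algebra.leftMulMatrix ν) ↔ x ∈ N)
    (ha : ∀ I : FractionalIdeal (endOrder (Algebra.leftMulMatrix μ))⁰ K, I ≠ 0 → N * I = I → N / (N / I) = I)
    {T' : FractionalIdeal (endOrder (Algebra.leftMulMatrix ν))⁰ K}
    (hT' : (T' : Submodule (endOrder (Algebra.leftMulMatrix ν)) K) =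
      traceDual ℤ ℚ ((1 : FractionalIdeal (endOrder (Algebra.leftMulMatrix ν))⁰ K) :
        Submodule (endOrder (Algebra.leftMulMatrix ν)) K)) :
    IsUnit T' := by
  have hN0 : N ≠ 0 := fun h ↦ by
    have h1 : (1 : K) ∈ N := (hν 1).1 (Subring.one_mem _)
    rw [h] at h1
    exact one_ne_zero ((mem_zero_iff _).1 h1)
  obtain ⟨TN, hTN0, hTN⟩ := exists_coe_eq_traceDual μ hN0
  exact isUnit_traceDual_one_of_traceDual_mul_eq μ hNN hν hTN
    ((forall_div_div_eq_iff_traceDual_mul_div_eq μ hNN hN0 hTN0 hTN).1 ha) hT'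

/-- **Conversely, `Tᵗ` invertible for every presentation `T = endOrder (M_ν) ⊇ S` ⟹ BUCHMANN–LENSTRA (a) for every
over-order `N = NN ≠ 0` on the base carrier** (g29-#3's transport `exists_traceDual_mul_eq_of_isUnit` and
`CMOrderGorenstein`'s (c) ⟹ (a)). [cite: BuchmannLenstra1994, §2 Prop. 2.7 ((c) ⟹ (a)), p. 230]
[cite: Marseglia2024CMType, §4 Prop. 4.6 (ii), p. 10] -/
theorem div_div_eq_of_forall_isUnit_traceDual_one
    (hG : ∀ ν : Basis ι ℚ K, endOrder (Algebra.leftMulMatrix μ) ≤ endOrder (Algebra.leftMulMatrix ν) →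
      ∀ T' : FractionalIdeal (endOrder (Algebra.leftMulMatrix ν))⁰ K,
        (T' : Submodule (endOrder (Algebra.leftMulMatrix ν)) K) =
          traceDual ℤ ℚ ((1 : FractionalIdeal (endOrder (Algebra.leftMulMatrix ν))⁰ K) :
            Submodule (endOrder (Algebra.leftMulMatrix ν)) K) → IsUnit T')
    {N : FractionalIdeal (endOrder (Algebra.leftMulMatrix μ))⁰ K} (hN0 : N ≠ 0) (hNN : N * N = N)
    {I : FractionalIdeal (endOrder (Algebra.leftMulMatrix μ))⁰ K} (hI : I ≠ 0) (hNI : N * I = I) :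
    N / (N / I) = I := by
  obtain ⟨ν, hν, hST⟩ := exists_basis_mem_endOrder_iff_mem μ hNN hN0
  haveI := isFractionRing_endOrder (Algebra.leftMulMatrix ν)
  obtain ⟨T', -, hT'⟩ := exists_coe_eq_traceDual ν
    (one_ne_zero' (FractionalIdeal (endOrder (Algebra.leftMulMatrix ν))⁰ K))
  obtain ⟨TN, -, hTN⟩ := exists_coe_eq_traceDual μ hN0
  obtain ⟨B, hB⟩ := exists_traceDual_mul_eq_of_isUnit μ hν hST hT' (hG ν hST T' hT') hTN
  exact div_div_eq_of_traceDual_mul_eq μ hNN hN0 hTN hB hI hNI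

omit [IsFractionRing (endOrder (Algebra.leftMulMatrix μ)) K] in
/-- **(v) ⟹ (ii), ring-theoretic form: if every nonzero fractional `S`-ideal is generated by two elements then the
trace dual `Tᵗ` of every over-order `T = endOrder (M_ν) ⊇ S` is invertible** (`gens_T ≤ gens_S ≤ 2`, THEOREM 4.7's
`type(T) + 1 ≤ gens(T)` for `T ≠ 𝒪_K`, `type(𝒪_K) = 1`; then PROP. 3.4 (2) ⟹ (3)). [cite: Marseglia2024CMType, §4
Prop. 4.6 ((v) ⟹ (i) ⟹ (ii)) and Thm. 4.7, pp. 10–11] [cite: Greither1982TwoGenerator, §2 Thm. 2.3 ((c) ⟹ (e)), p. 268] -/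
theorem isUnit_traceDual_one_of_forall_spanFinrank_coe_le_two
    (h2 : ∀ I : FractionalIdeal (endOrder (Algebra.leftMulMatrix μ))⁰ K, I ≠ 0 →
      (I : Submodule (endOrder (Algebra.leftMulMatrix μ)) K).spanFinrank ≤ 2)
    {ν : Basis ι ℚ K} (hST : endOrder (Algebra.leftMulMatrix μ) ≤ endOrder (Algebra.leftMulMatrix ν))
    [IsFractionRing (endOrder (Algebra.leftMulMatrix ν)) K]
    {T' : FractionalIdeal (endOrder (Algebra.leftMulMatrix ν))⁰ K}
    (hT' : (T' : Submodule (endOrder (Algebra.leftMulMatrix ν)) K) =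
      traceDual ℤ ℚ ((1 : FractionalIdeal (endOrder (Algebra.leftMulMatrix ν))⁰ K) :
        Submodule (endOrder (Algebra.leftMulMatrix ν)) K)) :
    IsUnit T' := by
  refine (forall_finrank_traceDual_quotient_eq_one_iff_isUnit ν hT').1
    ((iSup_finrank_traceDual_quotient_eq_one_iff ν hT').1 ?_)
  by_cases hS' : ∃ a : 𝓞 K, (a : K) ∉ endOrder (Algebra.leftMulMatrix ν)
  · have h := iSup_finrank_traceDual_quotient_add_one_le_iSup_spanFinrank ν hT' hS'
    haveI : Nonempty {I' : FractionalIdeal (endOrder (Algebra.leftMulMatrix ν))⁰ K // I' ≠ 0} := ⟨⟨1, one_ne_zero⟩⟩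
    have h2' : ⨆ I' : {I' : FractionalIdeal (endOrder (Algebra.leftMulMatrix ν))⁰ K // I' ≠ 0},
        ((I' : FractionalIdeal (endOrder (Algebra.leftMulMatrix ν))⁰ K) :
          Submodule (endOrder (Algebra.leftMulMatrix ν)) K).spanFinrank ≤ 2 :=
      ciSup_le fun I' ↦ by
        obtain ⟨I, hI0, hI⟩ := exists_ne_zero_coe_eq_coe_of_le μ hST I'.2
        exact (spanFinrank_coe_le_spanFinrank_coe_of_le μ hST hI).trans (h2 I hI0)
    have h1 := one_le_iSup_finrank_traceDual_quotient ν hT'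
    omega
  · push Not at hS'
    exact iSup_finrank_traceDual_quotient_eq_one_of_forall_mem ν hT' hS'

/-- **MARSEGLIA 2024 PROPOSITION 4.6, (ii) ⟹ «`dim_{S/𝔭} 𝒪_K/𝔭𝒪_K ≤ 2` at every maximal `𝔭`»**: if every over-order
`N = NN ≠ 0` of `S` is Gorenstein (BUCHMANN–LENSTRA (a): `N:(N:I) = I` for every `N`-ideal `I ≠ 0`) then
`dim_{S/𝔭} 𝒪_K/𝔭𝒪_K ≤ 2` — at an invertible `𝔭` the dimension is `1` (LEMMA 2.14 (i)); at a non-invertible `𝔭`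
PROPOSITION 4.5 gives `dim = 1 + type(S + 𝔭𝒪_K) = 2`. [cite: Marseglia2024CMType, §4 Prop. 4.5 and Prop. 4.6,
p. 10; §2.5 Lemma 2.14 (i), p. 7] [cite: Greither1982TwoGenerator, §2 Thm. 2.1 («`S` has multiplicity at most two
over `R`»), p. 267] -/
theorem finrank_quotient_smul_top_le_two_of_forall_div_div_eq
    {M : FractionalIdeal (endOrder (Algebra.leftMulMatrix μ))⁰ K}
    (hMO : (M : Set K) = (algebraMap (𝓞 K) K).range)
    (ha : ∀ N : FractionalIdeal (endOrder (Algebra.leftMulMatrix μ))⁰ K, N ≠ 0 → N * N = N →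
      ∀ I : FractionalIdeal (endOrder (Algebra.leftMulMatrix μ))⁰ K, I ≠ 0 → N * I = I → N / (N / I) = I)
    (𝔭 : MaximalSpectrum (endOrder (Algebra.leftMulMatrix μ))) :
    Module.finrank (endOrder (Algebra.leftMulMatrix μ) ⧸ 𝔭.asIdeal)
        ((M : Submodule (endOrder (Algebra.leftMulMatrix μ)) K) ⧸
          (𝔭.asIdeal • ⊤ : Submodule (endOrder (Algebra.leftMulMatrix μ))
            (M : Submodule (endOrder (Algebra.leftMulMatrix μ)) K))) ≤ 2 := by
  haveI := 𝔭.isMaximal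
  have h0 : 𝔭.asIdeal ≠ ⊥ := Ring.ne_bot_of_isMaximal_of_not_isField 𝔭.isMaximal EndOrder.not_isField
  obtain ⟨hMMle, h1M⟩ := EndOrder.mul_self_le_and_one_mem_of_coe_eq_range hMO
  have hM0 : M ≠ 0 := fun h ↦ by
    rw [h] at h1M
    exact one_ne_zero ((mem_zero_iff _).1 h1M)
  by_cases hu : IsUnit (𝔭.asIdeal : FractionalIdeal (endOrder (Algebra.leftMulMatrix μ))⁰ K)
  · exact (EndOrder.finrank_quotient_eq_one_of_isUnit_coeIdeal h0 hu hM0).le.trans one_le_two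
  obtain ⟨ν, hν, -, hdim⟩ := exists_basis_finrank_quotient_smul_top_eq_iSup_add_one μ hMO hu
  haveI := isFractionRing_endOrder (Algebra.leftMulMatrix ν)
  obtain ⟨T', -, hT'⟩ := exists_coe_eq_traceDual ν
    (one_ne_zero' (FractionalIdeal (endOrder (Algebra.leftMulMatrix ν))⁰ K))
  rw [hdim T' hT']
  -- the over-order `N = S + 𝔭𝒪_K = 1 + 𝔭M` on the base carrier
  set N : FractionalIdeal (endOrder (Algebra.leftMulMatrix μ))⁰ K :=
    1 + (𝔭.asIdeal : FractionalIdeal (endOrder (Algebra.leftMulMatrix μ))⁰ K) * M with hN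
  have hMM := EndOrder.mul_self_eq_of_one_mem_of_mul_self_le h1M hMMle
  have hNN : N * N = N := EndOrder.one_add_mul_mul_self_eq hMM 𝔭.asIdeal
  have hν' : ∀ x : K, x ∈ endOrder (Algebra.leftMulMatrix ν) ↔ x ∈ N := fun x ↦ by
    rw [hν x, hN, ← mem_coe, coe_add, Submodule.add_eq_sup, Submodule.mem_sup]
    constructor
    · rintro ⟨s, hs, y, hy, rfl⟩
      exact ⟨s, mem_coe.2 ((mem_one_iff _).2 ⟨⟨s, hs⟩, rfl⟩), y, mem_coe.2 hy, rfl⟩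
    · rintro ⟨a, ha, y, hy, rfl⟩
      rw [mem_coe, mem_one_iff] at ha
      obtain ⟨s, rfl⟩ := ha
      exact ⟨s, s.2, y, mem_coe.1 hy, rfl⟩
  have hN0 : N ≠ 0 := fun h ↦ by
    have h1 : (1 : K) ∈ N := (hν' 1).1 (Subring.one_mem _)
    rw [h] at h1
    exact one_ne_zero ((mem_zero_iff _).1 h1)
  have hi : (⨆ 𝔔 : MaximalSpectrum (endOrder (Algebra.leftMulMatrix ν)),
      Module.finrank (endOrder (Algebra.leftMulMatrix ν) ⧸ 𝔔.asIdeal)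
        ((T' : Submodule (endOrder (Algebra.leftMulMatrix ν)) K) ⧸
          (𝔔.asIdeal • ⊤ : Submodule (endOrder (Algebra.leftMulMatrix ν))
            (T' : Submodule (endOrder (Algebra.leftMulMatrix ν)) K)))) = 1 :=
    (iSup_finrank_traceDual_quotient_eq_one_iff ν hT').2
      ((forall_finrank_traceDual_quotient_eq_one_iff_isUnit ν hT').2
        (isUnit_traceDual_one_of_forall_div_div_eq μ hNN hν' (ha N hN0 hNN) hT'))
  omega

/-- **MARSEGLIA 2024 PROPOSITION 4.6, (ii) ⟹ (iv): if every over-order of `S` is Gorenstein (BUCHMANN–LENSTRA (a)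
on the base carrier) then `𝒪_K = S + Sω` — «the `S`-module `𝒪_K/S` is cyclic»** (GREITHER THM. 2.3 (e) ⟹ (a)).
[cite: Marseglia2024CMType, §4 Prop. 4.6 ((ii) ⟹ (iv)), p. 10] [cite: Greither1982TwoGenerator, §2 Thm. 2.3, p. 268] -/
theorem exists_coe_eq_span_pair_of_forall_div_div_eq
    {M : FractionalIdeal (endOrder (Algebra.leftMulMatrix μ))⁰ K}
    (hMO : (M : Set K) = (algebraMap (𝓞 K) K).range)
    (ha : ∀ N : FractionalIdeal (endOrder (Algebra.leftMulMatrix μ))⁰ K, N ≠ 0 → N * N = N →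
      ∀ I : FractionalIdeal (endOrder (Algebra.leftMulMatrix μ))⁰ K, I ≠ 0 → N * I = I → N / (N / I) = I) :
    ∃ ω ∈ M, (M : Submodule (endOrder (Algebra.leftMulMatrix μ)) K) =
      Submodule.span (endOrder (Algebra.leftMulMatrix μ)) {1, ω} :=
  exists_coe_eq_span_pair_of_forall_finrank_quotient_le_two μ hMO
    (finrank_quotient_smul_top_le_two_of_forall_div_div_eq μ hMO ha)

/-- **PROPOSITION 4.6, (ii) ⟹ (iv), ring-theoretic form: if `Tᵗ` is invertible for every over-order
`T = endOrder (M_ν) ⊇ S` then `𝒪_K = S + Sω`.** [cite: Marseglia2024CMType, §4 Prop. 4.6 ((ii) ⟹ (iv)), p. 10]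
[cite: Greither1982TwoGenerator, §2 Thm. 2.3 ((e) ⟹ (a)), p. 268] -/
theorem exists_coe_eq_span_pair_of_forall_isUnit_traceDual_one
    {M : FractionalIdeal (endOrder (Algebra.leftMulMatrix μ))⁰ K}
    (hMO : (M : Set K) = (algebraMap (𝓞 K) K).range)
    (hG : ∀ ν : Basis ι ℚ K, endOrder (Algebra.leftMulMatrix μ) ≤ endOrder (Algebra.leftMulMatrix ν) →
      ∀ T' : FractionalIdeal (endOrder (Algebra.leftMulMatrix ν))⁰ K,
        (T' : Submodule (endOrder (Algebra.leftMulMatrix ν)) K) =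
          traceDual ℤ ℚ ((1 : FractionalIdeal (endOrder (Algebra.leftMulMatrix ν))⁰ K) :
            Submodule (endOrder (Algebra.leftMulMatrix ν)) K) → IsUnit T') :
    ∃ ω ∈ M, (M : Submodule (endOrder (Algebra.leftMulMatrix μ)) K) =
      Submodule.span (endOrder (Algebra.leftMulMatrix μ)) {1, ω} :=
  exists_coe_eq_span_pair_of_forall_div_div_eq μ hMO fun _ hN0 hNN _ hI hNI ↦
    div_div_eq_of_forall_isUnit_traceDual_one μ hG hN0 hNN hI hNI

/-- **MARSEGLIA 2024 PROPOSITION 4.6, (v) ⟹ (iv): if every nonzero fractional `S`-ideal is generated by two elements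
then `𝒪_K = S + Sω`** (GREITHER THM. 2.3 (c) ⟹ (a)). [cite: Marseglia2024CMType, §4 Prop. 4.6 ((v) ⟹ (i) ⟹ (ii) ⟹
(iv)), pp. 10–11] [cite: Greither1982TwoGenerator, §2 Thm. 2.3 ((c) ⟹ (a)), p. 268] -/
theorem exists_coe_eq_span_pair_of_forall_spanFinrank_coe_le_two
    {M : FractionalIdeal (endOrder (Algebra.leftMulMatrix μ))⁰ K}
    (hMO : (M : Set K) = (algebraMap (𝓞 K) K).range)
    (h2 : ∀ I : FractionalIdeal (endOrder (Algebra.leftMulMatrix μ))⁰ K, I ≠ 0 →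
      (I : Submodule (endOrder (Algebra.leftMulMatrix μ)) K).spanFinrank ≤ 2) :
    ∃ ω ∈ M, (M : Submodule (endOrder (Algebra.leftMulMatrix μ)) K) =
      Submodule.span (endOrder (Algebra.leftMulMatrix μ)) {1, ω} :=
  exists_coe_eq_span_pair_of_forall_isUnit_traceDual_one μ hMO fun ν hST T' hT' ↦ by
    haveI := isFractionRing_endOrder (Algebra.leftMulMatrix ν)
    exact isUnit_traceDual_one_of_forall_spanFinrank_coe_le_two μ h2 hST hT'

end BassConverse

/-! ## §3 PROPOSITION 4.6: the equivalences -/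

section Bass

variable {K : Type} [Field K] [NumberField K]
variable {ι : Type} [Fintype ι] [DecidableEq ι] (μ : Basis ι ℚ K) [Nonempty ι]
variable [IsFractionRing (endOrder (Algebra.leftMulMatrix μ)) K]

/-- **MARSEGLIA 2024 PROPOSITION 4.6, (iv) ⟺ (ii) on the base carrier: `𝒪_K = S + Sω` for some `ω` iff every
over-order `N = NN ≠ 0` of `S` is Gorenstein in BUCHMANN–LENSTRA's form (a), `N:(N:I) = I` for all `N`-ideals
`I ≠ 0`.** [cite: Marseglia2024CMType, §4 Prop. 4.6 ((ii) ⟺ (iv)), p. 10] [cite: BuchmannLenstra1994, §2 Prop. 2.7,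
p. 230] [cite: Greither1982TwoGenerator, §2 Thm. 2.3 ((a) ⟺ (e)), p. 268] -/
theorem exists_coe_eq_span_pair_iff_forall_div_div_eq
    {M : FractionalIdeal (endOrder (Algebra.leftMulMatrix μ))⁰ K}
    (hMO : (M : Set K) = (algebraMap (𝓞 K) K).range) :
    (∃ ω ∈ M, (M : Submodule (endOrder (Algebra.leftMulMatrix μ)) K) =
        Submodule.span (endOrder (Algebra.leftMulMatrix μ)) {1, ω}) ↔
      ∀ N : FractionalIdeal (endOrder (Algebra.leftMulMatrix μ))⁰ K, N ≠ 0 → N * N = N →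
        ∀ I : FractionalIdeal (endOrder (Algebra.leftMulMatrix μ))⁰ K, I ≠ 0 → N * I = I → N / (N / I) = I :=
  ⟨fun ⟨_, _, hcyc⟩ _ hN0 hNN _ hI hNI ↦ div_div_eq_of_coe_eq_span_pair μ hMO hcyc hN0 hNN hI hNI,
    exists_coe_eq_span_pair_of_forall_div_div_eq μ hMO⟩

/-- **MARSEGLIA 2024 PROPOSITION 4.6, (iv) ⟺ (ii) «every overorder of `S` is Gorenstein»: `𝒪_K = S + Sω` iff the
trace dual `Tᵗ` of every over-order `T = endOrder (M_ν) ⊇ S` is an invertible fractional `T`-ideal.**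
[cite: Marseglia2024CMType, §4 Prop. 4.6 ((ii) ⟺ (iv)) and §3 Prop. 3.4 (3), pp. 9–10] [cite: Greither1982TwoGenerator,
§2 Thm. 2.3 ((a) ⟺ (e)), p. 268] -/
theorem exists_coe_eq_span_pair_iff_forall_isUnit_traceDual_one
    {M : FractionalIdeal (endOrder (Algebra.leftMulMatrix μ))⁰ K}
    (hMO : (M : Set K) = (algebraMap (𝓞 K) K).range) :
    (∃ ω ∈ M, (M : Submodule (endOrder (Algebra.leftMulMatrix μ)) K) =
        Submodule.span (endOrder (Algebra.leftMulMatrix μ)) {1, ω}) ↔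
      ∀ ν : Basis ι ℚ K, endOrder (Algebra.leftMulMatrix μ) ≤ endOrder (Algebra.leftMulMatrix ν) →
        ∀ T' : FractionalIdeal (endOrder (Algebra.leftMulMatrix ν))⁰ K,
          (T' : Submodule (endOrder (Algebra.leftMulMatrix ν)) K) =
            traceDual ℤ ℚ ((1 : FractionalIdeal (endOrder (Algebra.leftMulMatrix ν))⁰ K) :
              Submodule (endOrder (Algebra.leftMulMatrix ν)) K) → IsUnit T' :=
  ⟨fun ⟨_, _, hcyc⟩ ν hST T' hT' ↦ by
      haveI := isFractionRing_endOrder (Algebra.leftMulMatrix ν)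
      exact isUnit_traceDual_of_le μ hMO hcyc hST hT',
    exists_coe_eq_span_pair_of_forall_isUnit_traceDual_one μ hMO⟩

/-- **MARSEGLIA 2024 PROPOSITION 4.6, (iv) ⟺ (i) «for every overorder `T` of `S` we have `type(T) = 1`»: `𝒪_K = S + Sω`
iff `type(T) = ⨆_𝔔 type_𝔔(T) = 1` for every over-order `T = endOrder (M_ν) ⊇ S`** ((i) ⟺ (ii) «is a direct
consequence of Proposition 3.4»). [cite: Marseglia2024CMType, §4 Prop. 4.6 ((i) ⟺ (iv)) and §3 Prop. 3.4, pp. 9–10] -/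
theorem exists_coe_eq_span_pair_iff_forall_iSup_finrank_traceDual_quotient_eq_one
    {M : FractionalIdeal (endOrder (Algebra.leftMulMatrix μ))⁰ K}
    (hMO : (M : Set K) = (algebraMap (𝓞 K) K).range) :
    (∃ ω ∈ M, (M : Submodule (endOrder (Algebra.leftMulMatrix μ)) K) =
        Submodule.span (endOrder (Algebra.leftMulMatrix μ)) {1, ω}) ↔
      ∀ ν : Basis ι ℚ K, endOrder (Algebra.leftMulMatrix μ) ≤ endOrder (Algebra.leftMulMatrix ν) →
        ∀ T' : FractionalIdeal (endOrder (Algebra.leftMulMatrix ν))⁰ K,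
          (T' : Submodule (endOrder (Algebra.leftMulMatrix ν)) K) =
            traceDual ℤ ℚ ((1 : FractionalIdeal (endOrder (Algebra.leftMulMatrix ν))⁰ K) :
              Submodule (endOrder (Algebra.leftMulMatrix ν)) K) →
          ⨆ 𝔔 : MaximalSpectrum (endOrder (Algebra.leftMulMatrix ν)),
              Module.finrank (endOrder (Algebra.leftMulMatrix ν) ⧸ 𝔔.asIdeal)
                ((T' : Submodule (endOrder (Algebra.leftMulMatrix ν)) K) ⧸
                  (𝔔.asIdeal • ⊤ : Submodule (endOrder (Algebra.leftMulMatrix ν))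
                    (T' : Submodule (endOrder (Algebra.leftMulMatrix ν)) K))) = 1 := by
  rw [exists_coe_eq_span_pair_iff_forall_isUnit_traceDual_one μ hMO]
  refine forall_congr' fun ν ↦ forall_congr' fun hST ↦ forall_congr' fun T' ↦ forall_congr' fun hT' ↦ ?_
  haveI := isFractionRing_endOrder (Algebra.leftMulMatrix ν)
  rw [← forall_finrank_traceDual_quotient_eq_one_iff_isUnit ν hT', iSup_finrank_traceDual_quotient_eq_one_iff ν hT']

/-- **MARSEGLIA 2024 PROPOSITION 4.6, (iv) ⟺ (iii) «every fractional `S`-ideal `I` is invertible as a fractional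
`(I:I)`-ideal»: `𝒪_K = S + Sω` iff `I·((I:I):I) = (I:I)` for every `I ≠ 0`.** [cite: Marseglia2024CMType, §4
Prop. 4.6 ((iii) ⟺ (iv)), p. 10] [cite: Marseglia2019, §3 Prop. 3.7 ((a) ⟺ (b)), p. 6] -/
theorem exists_coe_eq_span_pair_iff_forall_mul_div_self_div_eq
    {M : FractionalIdeal (endOrder (Algebra.leftMulMatrix μ))⁰ K}
    (hMO : (M : Set K) = (algebraMap (𝓞 K) K).range) :
    (∃ ω ∈ M, (M : Submodule (endOrder (Algebra.leftMulMatrix μ)) K) =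
        Submodule.span (endOrder (Algebra.leftMulMatrix μ)) {1, ω}) ↔
      ∀ I : FractionalIdeal (endOrder (Algebra.leftMulMatrix μ))⁰ K, I ≠ 0 → I * (I / I / I) = I / I := by
  rw [exists_coe_eq_span_pair_iff_forall_div_div_eq μ hMO,
    forall_overorder_div_div_eq_iff_forall_mul_div_self_div_eq μ]

/-- **Bass ⟺ `ICM(S)` is Clifford: `𝒪_K = S + Sω` iff every nonzero fractional `S`-ideal is invertible in an
over-order over which it is a module** (MARSEGLIA 2019 PROP. 3.7 (a) ⟺ (c); MARSEGLIA 2024 COR. 5.3 «`ICM(S) = ⊔_T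
Pic(T)`» for Bass orders). [cite: Marseglia2019, §3 Prop. 3.7, p. 6] [cite: Marseglia2024CMType, §4 Prop. 4.6 and §5
Cor. 5.3, pp. 10, 13] -/
theorem exists_coe_eq_span_pair_iff_forall_exists_idempotent_invertible
    {M : FractionalIdeal (endOrder (Algebra.leftMulMatrix μ))⁰ K}
    (hMO : (M : Set K) = (algebraMap (𝓞 K) K).range) :
    (∃ ω ∈ M, (M : Submodule (endOrder (Algebra.leftMulMatrix μ)) K) =
        Submodule.span (endOrder (Algebra.leftMulMatrix μ)) {1, ω}) ↔
      ∀ I : FractionalIdeal (endOrder (Algebra.leftMulMatrix μ))⁰ K, I ≠ 0 →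
        ∃ N J : FractionalIdeal (endOrder (Algebra.leftMulMatrix μ))⁰ K, N ≠ 0 ∧ N * N = N ∧ N * I = I ∧ I * J = N := by
  rw [exists_coe_eq_span_pair_iff_forall_mul_div_self_div_eq μ hMO,
    forall_mul_div_self_div_eq_iff_forall_exists_idempotent_invertible μ]

/-- **MARSEGLIA 2024 PROPOSITION 4.6, (iv) ⟺ «every fractional `S`-ideal is generated by two elements»**
(GREITHER THM. 2.3 (a) ⟺ (c)). [cite: Marseglia2024CMType, §4 Prop. 4.6 ((iv) ⟺ (v)), pp. 10–11]
[cite: Greither1982TwoGenerator, §2 Thm. 2.3 ((a) ⟺ (c)), p. 268] -/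
theorem exists_coe_eq_span_pair_iff_forall_spanFinrank_coe_le_two
    {M : FractionalIdeal (endOrder (Algebra.leftMulMatrix μ))⁰ K}
    (hMO : (M : Set K) = (algebraMap (𝓞 K) K).range) :
    (∃ ω ∈ M, (M : Submodule (endOrder (Algebra.leftMulMatrix μ)) K) =
        Submodule.span (endOrder (Algebra.leftMulMatrix μ)) {1, ω}) ↔
      ∀ I : FractionalIdeal (endOrder (Algebra.leftMulMatrix μ))⁰ K, I ≠ 0 →
        (I : Submodule (endOrder (Algebra.leftMulMatrix μ)) K).spanFinrank ≤ 2 :=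
  ⟨fun ⟨_, _, hcyc⟩ _ hI ↦ spanFinrank_coe_le_two_of_coe_eq_span_pair' μ hMO hcyc hI,
    exists_coe_eq_span_pair_of_forall_spanFinrank_coe_le_two μ hMO⟩

/-- **MARSEGLIA 2024 PROPOSITION 4.6, (iv) ⟺ (v) «`gens(S) = 2`», for a non-maximal order `S ≠ 𝒪_K`: `𝒪_K = S + Sω`
iff `gens(S) = ⨆_{I ≠ 0} gens_S(I) = 2`.** [cite: Marseglia2024CMType, §4 Prop. 4.6 ((iv) ⟺ (v)) and Def. 4.1,
pp. 10–11] [cite: Greither1982TwoGenerator, §2 Thm. 2.3 ((a) ⟺ (c)), p. 268] -/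
theorem exists_coe_eq_span_pair_iff_iSup_spanFinrank_coe_eq_two
    {M : FractionalIdeal (endOrder (Algebra.leftMulMatrix μ))⁰ K}
    (hMO : (M : Set K) = (algebraMap (𝓞 K) K).range)
    (hS : ∃ a : 𝓞 K, (a : K) ∉ endOrder (Algebra.leftMulMatrix μ)) :
    (∃ ω ∈ M, (M : Submodule (endOrder (Algebra.leftMulMatrix μ)) K) =
        Submodule.span (endOrder (Algebra.leftMulMatrix μ)) {1, ω}) ↔
      ⨆ I : {I : FractionalIdeal (endOrder (Algebra.leftMulMatrix μ))⁰ K // I ≠ 0},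
          ((I : FractionalIdeal (endOrder (Algebra.leftMulMatrix μ))⁰ K) :
            Submodule (endOrder (Algebra.leftMulMatrix μ)) K).spanFinrank = 2 := by
  refine ⟨fun ⟨_, _, hcyc⟩ ↦ iSup_spanFinrank_coe_eq_two_of_coe_eq_span_pair μ hMO hcyc hS, fun h ↦ ?_⟩
  exact exists_coe_eq_span_pair_of_forall_spanFinrank_coe_le_two μ hMO fun I hI ↦
    (spanFinrank_coe_le_iSup μ hI).trans h.le

omit [Nonempty ι] [IsFractionRing (endOrder (Algebra.leftMulMatrix μ)) K] in
/-- **An over-order of a Bass order is Bass, with the same generator: if `𝒪_K = S + Sω` and `S ⊆ T = endOrder (M_ν)`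
then `𝒪_K = T + Tω`** (for the maximal order `M′` in `FractionalIdeal T⁰ K`; an `S`-combination of `1, ω` is a
`T`-combination). [cite: Marseglia2024CMType, §4 Prop. 4.6 (iv) and Thm. 4.7 (proof: «every fractional `T`-ideal
`I` is also a fractional `S`-ideal»), pp. 10–11] [cite: Greither1982TwoGenerator, §2 Thm. 2.3 ((a) ⟹ (e) «every ring
between `R` and `S`»), p. 268] -/
theorem coe_eq_span_pair_of_le {M : FractionalIdeal (endOrder (Algebra.leftMulMatrix μ))⁰ K}
    (hMO : (M : Set K) = (algebraMap (𝓞 K) K).range)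
    {ω : K} (hcyc : (M : Submodule (endOrder (Algebra.leftMulMatrix μ)) K) =
      Submodule.span (endOrder (Algebra.leftMulMatrix μ)) {1, ω})
    {ν : Basis ι ℚ K} (hST : endOrder (Algebra.leftMulMatrix μ) ≤ endOrder (Algebra.leftMulMatrix ν))
    {M' : FractionalIdeal (endOrder (Algebra.leftMulMatrix ν))⁰ K}
    (hMO' : (M' : Set K) = (algebraMap (𝓞 K) K).range) :
    (M' : Submodule (endOrder (Algebra.leftMulMatrix ν)) K) = Submodule.span (endOrder (Algebra.leftMulMatrix ν)) {1, ω} := by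
  have hmem : ∀ x : K, x ∈ (M' : Submodule (endOrder (Algebra.leftMulMatrix ν)) K) ↔
      x ∈ (M : Submodule (endOrder (Algebra.leftMulMatrix μ)) K) := fun x ↦ by
    rw [mem_coe, mem_coe, ← SetLike.mem_coe, hMO', ← hMO, SetLike.mem_coe]
  refine le_antisymm (fun x hx ↦ ?_) (Submodule.span_le.2 ?_)
  · have hx' := (hmem x).1 hx
    rw [hcyc, Submodule.mem_span_pair] at hx'
    obtain ⟨s, t, rfl⟩ := hx'
    rw [Submodule.mem_span_pair]
    exact ⟨⟨(s : K), hST s.2⟩, ⟨(t : K), hST t.2⟩, by simp only [Subring.smul_def]⟩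
  · have h1ω : ({1, ω} : Set K) ⊆ (M : Submodule (endOrder (Algebra.leftMulMatrix μ)) K) := by
      rw [hcyc]; exact Submodule.subset_span
    intro x hx
    exact (hmem x).2 (h1ω hx)

omit [Nonempty ι] [IsFractionRing (endOrder (Algebra.leftMulMatrix μ)) K] in
/-- **Over-orders of Bass orders are Bass: if `𝒪_K/S` is cyclic then `𝒪_K/T` is cyclic for every over-order
`T = endOrder (M_ν) ⊇ S`.** [cite: Marseglia2024CMType, §4 Prop. 4.6, pp. 10–11] [cite: Greither1982TwoGenerator, §2
Thm. 2.3, p. 268] -/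
theorem exists_coe_eq_span_pair_of_le {M : FractionalIdeal (endOrder (Algebra.leftMulMatrix μ))⁰ K}
    (hMO : (M : Set K) = (algebraMap (𝓞 K) K).range)
    (hcyc : ∃ ω ∈ M, (M : Submodule (endOrder (Algebra.leftMulMatrix μ)) K) =
      Submodule.span (endOrder (Algebra.leftMulMatrix μ)) {1, ω})
    {ν : Basis ι ℚ K} (hST : endOrder (Algebra.leftMulMatrix μ) ≤ endOrder (Algebra.leftMulMatrix ν))
    {M' : FractionalIdeal (endOrder (Algebra.leftMulMatrix ν))⁰ K}
    (hMO' : (M' : Set K) = (algebraMap (𝓞 K) K).range) :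
    ∃ ω ∈ M', (M' : Submodule (endOrder (Algebra.leftMulMatrix ν)) K) =
      Submodule.span (endOrder (Algebra.leftMulMatrix ν)) {1, ω} := by
  obtain ⟨ω, hωM, hcyc⟩ := hcyc
  refine ⟨ω, ?_, coe_eq_span_pair_of_le μ hMO hcyc hST hMO'⟩
  rw [← SetLike.mem_coe, hMO', ← hMO, SetLike.mem_coe]
  exact hωM

/-- **GREITHER PROPOSITION 1.1 «`R` is a Q-ring iff `S` is finitely generated over `R` and `[S/mS : R/m]` is at most
two», globally for `S = endOrder (M_μ) ⊆ 𝒪_K`: `𝒪_K = S + Sω` for some `ω` iff `dim_{S/𝔭} 𝒪_K/𝔭𝒪_K ≤ 2` at every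
maximal `𝔭`** (⟸ is §2; ⟹ is `CMOrderBassCyclicQuotient`). [cite: Greither1982TwoGenerator, §1 Prop. 1.1 and
Lemma 1.3, pp. 266–267] [cite: Marseglia2024CMType, §4 Prop. 4.6 ((iv)) with Prop. 4.5, p. 10] -/
theorem exists_coe_eq_span_pair_iff_forall_finrank_quotient_le_two
    {M : FractionalIdeal (endOrder (Algebra.leftMulMatrix μ))⁰ K}
    (hMO : (M : Set K) = (algebraMap (𝓞 K) K).range) :
    (∃ ω ∈ M, (M : Submodule (endOrder (Algebra.leftMulMatrix μ)) K) =
        Submodule.span (endOrder (Algebra.leftMulMatrix μ)) {1, ω}) ↔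
      ∀ 𝔭 : MaximalSpectrum (endOrder (Algebra.leftMulMatrix μ)),
        Module.finrank (endOrder (Algebra.leftMulMatrix μ) ⧸ 𝔭.asIdeal)
          ((M : Submodule (endOrder (Algebra.leftMulMatrix μ)) K) ⧸
            (𝔭.asIdeal • ⊤ : Submodule (endOrder (Algebra.leftMulMatrix μ))
              (M : Submodule (endOrder (Algebra.leftMulMatrix μ)) K))) ≤ 2 :=
  ⟨fun ⟨_, _, hcyc⟩ 𝔭 ↦ by
      haveI := 𝔭.isMaximal
      exact finrank_quotient_smul_top_le_two_of_coe_eq_span_pair μ hcyc (asIdeal_ne_bot μ 𝔭),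
    exists_coe_eq_span_pair_of_forall_finrank_quotient_le_two μ hMO⟩

/-- **… iff `gens_S(𝒪_K) ≤ 2`: `𝒪_K/S` is cyclic iff `𝒪_K` is generated by two elements as an `S`-module** (GREITHER:
«`R` is a Q-ring» ⟺ «`S` is 2-generated over `R`», LEMMA 1.3 with `n = 2`). [cite: Greither1982TwoGenerator, §1
Lemma 1.3 («`S` is `n`-generated over `R` iff `S_m` is `n`-generated over `R_m` for all maximal ideals»; «`R` is a
Q-ring iff `S/R` is cyclic»), p. 267] [cite: Marseglia2024CMType, §4 Prop. 4.6 ((iv) ⟺ (v)) and Cor. 4.4, p. 10] -/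
theorem exists_coe_eq_span_pair_iff_spanFinrank_coe_le_two
    {M : FractionalIdeal (endOrder (Algebra.leftMulMatrix μ))⁰ K}
    (hMO : (M : Set K) = (algebraMap (𝓞 K) K).range) :
    (∃ ω ∈ M, (M : Submodule (endOrder (Algebra.leftMulMatrix μ)) K) =
        Submodule.span (endOrder (Algebra.leftMulMatrix μ)) {1, ω}) ↔
      (M : Submodule (endOrder (Algebra.leftMulMatrix μ)) K).spanFinrank ≤ 2 := by
  refine ⟨fun ⟨_, _, hcyc⟩ ↦ spanFinrank_coe_le_two_of_coe_eq_span_pair μ hcyc, fun h2 ↦ ?_⟩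
  refine (exists_coe_eq_span_pair_iff_forall_finrank_quotient_le_two μ hMO).2 fun 𝔭 ↦ ?_
  haveI := 𝔭.isMaximal
  exact (EndOrder.finrank_quotient_smul_top_le_spanFinrank M (asIdeal_ne_bot μ 𝔭)).trans h2

/-- **… iff `dim_{S/𝔭} 𝒪_K/𝔭𝒪_K = 2` at every NON-invertible maximal `𝔭`** (at an invertible `𝔭` the dimension is
`1`, LEMMA 2.14 (i); at a non-invertible one it is `≥ 2`). [cite: Marseglia2024CMType, §4 Prop. 4.5 and Prop. 4.6,
p. 10; §2.5 Lemma 2.14 (i), p. 7] [cite: Greither1982TwoGenerator, §1 Prop. 1.1, p. 266] -/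
theorem exists_coe_eq_span_pair_iff_forall_not_isUnit_finrank_quotient_eq_two
    {M : FractionalIdeal (endOrder (Algebra.leftMulMatrix μ))⁰ K}
    (hMO : (M : Set K) = (algebraMap (𝓞 K) K).range) :
    (∃ ω ∈ M, (M : Submodule (endOrder (Algebra.leftMulMatrix μ)) K) =
        Submodule.span (endOrder (Algebra.leftMulMatrix μ)) {1, ω}) ↔
      ∀ 𝔭 : MaximalSpectrum (endOrder (Algebra.leftMulMatrix μ)),
        ¬ IsUnit (𝔭.asIdeal : FractionalIdeal (endOrder (Algebra.leftMulMatrix μ))⁰ K) →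
        Module.finrank (endOrder (Algebra.leftMulMatrix μ) ⧸ 𝔭.asIdeal)
          ((M : Submodule (endOrder (Algebra.leftMulMatrix μ)) K) ⧸
            (𝔭.asIdeal • ⊤ : Submodule (endOrder (Algebra.leftMulMatrix μ))
              (M : Submodule (endOrder (Algebra.leftMulMatrix μ)) K))) = 2 := by
  rw [exists_coe_eq_span_pair_iff_forall_finrank_quotient_le_two μ hMO]
  refine ⟨fun h 𝔭 hu ↦ ?_, fun h 𝔭 ↦ ?_⟩
  · haveI := 𝔭.isMaximal
    exact le_antisymm (h 𝔭) (finrank_quotient_smul_top_two_le_of_not_isUnit μ hMO (asIdeal_ne_bot μ 𝔭) hu)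
  · haveI := 𝔭.isMaximal
    by_cases hu : IsUnit (𝔭.asIdeal : FractionalIdeal (endOrder (Algebra.leftMulMatrix μ))⁰ K)
    · exact (EndOrder.finrank_quotient_eq_one_of_isUnit_coeIdeal (asIdeal_ne_bot μ 𝔭) hu
        (ne_zero_of_coe_eq_range μ hMO)).le.trans one_le_two
    · exact (h 𝔭 hu).le

end Bass

end CMTypeLattice

end Literature.NumberTheory.ComplexMultiplication
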